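/-
Copyright: the b2b-balaban T⁴-continuum CRUX team, row NE7b OWNER lineage `t4-ne7b-p1` (gen 137). Project licence.
-/
import Summits.QuantumFields.BalabanUV.T4Continuum.Spine.NE7b.SupBlockHessianBound
import Summits.QuantumFields.BalabanUV.T4Continuum.Spine.NE7b.SupBlockOutputDerivative
import Summits.QuantumFields.BalabanUV.T4Continuum.Spine.NE7b.SupBlockLocalClass

/-!
# THE OUTPUT'S SECOND-ORDER LETTERS IN THE INPUT FORMAT, UNIFORM: `κ₂⁺ = 2(2λ+Λ)`, `κ₁⁺ = 2λ+Λ` (`a⁺ = 1`), `Λ⁺ = Λ+2λ`, `λ⁺ = 2λ+Λ` —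
# the class-closure plan, item (b), completed.  For a `Y`-local `C²` block input `U` with the block letters, the two-point upper letter `Λ ≥ 0`
# on `Y` and the secant lower letter `λ ≥ 0` (`2λ ≤ m`, over `N(0,M⁻¹)`), the output `w⁺` of the dressed step at background `ψ₀` ((415)'s
# objects) satisfies, at EVERY `ζ` and uniformly in `ψ₀` and the volume:
#   `‖(w⁺)″(ζ)‖ ≤ 2(2λ+Λ)`   ((416): `‖HessW‖ ≤ 2λ+Λ` twice; the input's `hU''b`),
#   `‖(w⁺)′(ζ)‖ ≤ (2λ+Λ)(1 + Σ_Yζ²)`   ((416)'s mean value + locality (412); the input's `hU'b`),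
#   `w⁺(ζ′) ≤ w⁺(ζ) + (w⁺)′(ζ)[ζ′−ζ] + ½(Λ+2λ)Σ_Y(ζ′−ζ)²`   ((414)∕(415); the input's `hwup`),
#   `w⁺((1−s)a + sb) − ½(2λ+Λ)·s(1−s)·Σ_i(a_i−b_i)² ≤ (1−s)w⁺(a) + s·w⁺(b)`,  `0 ≤ s ≤ 1`   (tangent letters at the intermediate point; the
#   input's `hUsec`)
# — with (413) (`hstab`, `hUup`) and (415) (`hUd`, `hU'd`) EVERY INPUT LETTER OF ORDER ≤ 2 IS REGENERATED with explicit constants that ADD;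
# what remains of the class is the third order (row NE7b, node U5c; (412)–(416) BY NAME; [folklore])

Cell `pub-balaban`, sub-cell `t4`, spine estimate NE7b (`T4WeightBudget.RelWeightBound`; the cell's OWN estimate — NOT PRINTED in
[Bałaban 1983–89], NOT PROVED).  Crux-route work under `Spine/NE7b/` by the row OWNER (`t4-ne7b-p1` gen 137, file (417)) under FREEZE
(0)'s crux-prover clause (this gen's class-closure audit, item (b)); NOTHING of Bałaban's is named as a Lean object, valued or asserted; no
`T4Continuum/Support` leaf typed; no `def`, no notation; zero `sorry`.  Imports (BY NAME): the OWNER's (416) `…SupBlockHessianBound`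
(`hessW_opNorm_le`, `gradient_sub_le`), (415) `…SupBlockOutputDerivative` (`blockOutput_increment_eq`), (414) `…SupBlockLocalClass`
(`block_residual_second_order_class_local`, `sum_sq_proj_univ`), and through them (412) (`fderiv_local_of_local`, `block_W_local`,
`block_hessianCLM_apply_off`, `block_hessianCLM_apply_apply_off`), (399) (`hasFDerivAt_block_neg_log`).

WHAT IS PROVED ([folklore]):
* §1 `secant_arith` (the real-arithmetic step from two tangent letters to the secant letter), `blockOutput_deriv_local`,
  **`blockOutput_gradient_letter_local`** (`‖(w⁺)′(ζ)‖ ≤ (2λ+Λ)(1+Σ_Yζ²)`, from (416)'s `blockOutput_gradient_letter` by locality);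
* §2 **`blockOutput_upper_letter`** (`hwup` with `Λ⁺ = Λ+2λ`), **`blockOutput_secant`** (`hUsec` with `λ⁺ = 2λ+Λ`); §3 toy.

HONEST (what this is NOT).  The constants DOUBLE per step (`λ⁺ = Λ⁺ = 2λ+Λ`, `κ₂⁺ = 2(2λ+Λ)`) — turning them back in natural units is the
CONTRACTION (β4), NOT claimed; the third Fréchet derivative of `W`, its continuity and a UNIFORM `κ₃⁺` (log-concave concentration) are the
remaining files of the plan; no decaying-covariance polymer expansion ((β3′)); scalar skeleton ((A3), NC-NE7b-α UNRULED); nothing of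
Bałaban's asserted.  BY-NAME EFFECT ON THE WALL: NONE.  NE7b NOT PRINTED ∕ NOT PROVED; spine PROVED 0∕9; rung (B)+1 — the programme's measures
remain FINITE-torus statements; NOT the mass gap, NOT Clay.  HONEST DEPENDENCY: continuum YM on T⁴ ⇐ BetaPertH ∧ nine spine estimates (0∕9
proved); BetaPertH ⇐ (D1) ∧ (D4) ∧ CAP+tail; G-an2-4 gates asym, D1 and NE2∕3∕4.
-/

set_option autoImplicit false
set_option maxSynthPendingDepth 2

noncomputable section

namespace Summit.QuantumFields.BalabanUV.T4Continuum.NE7b.SupBlockOutputLetters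

open MeasureTheory ProbabilityTheory Finset Real Matrix
open scoped BigOperators
open SupBlockEffectiveActionDerivative (hasFDerivAt_block_neg_log)
open SupBlockLocality (fderiv_local_of_local block_W_local block_hessianCLM_apply_off block_hessianCLM_apply_apply_off)
open SupBlockLocalClass (sum_sq_proj_univ block_residual_second_order_class_local)
open SupBlockOutputDerivative (blockOutput_increment_eq)
open SupBlockHessianBound (blockOutput_gradient_letter)

variable {ι : Type} [Fintype ι] [DecidableEq ι]

/-! ## §1. The output's gradient letter on `Y` -/

/-- **From two tangent letters to the secant letter** (real arithmetic): with `c ≥ 0`, `0 ≤ s ≤ 1`, the tangent letters at the intermediate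
point towards both ends, the cancelling linear parts and `Q_Y ≤ Q`: `w_m − c·s(1−s)·Q ≤ (1−s)w_a + s·w_b`. [folklore] -/
theorem secant_arith {c s wa wb wm Da Db QY Q : ℝ} (hc : 0 ≤ c) (hs0 : 0 ≤ s) (hs1 : s ≤ 1)
    (ha : -(c * (s ^ 2 * QY)) ≤ wa - wm - Da) (hb : -(c * ((1 - s) ^ 2 * QY)) ≤ wb - wm - Db)
    (hlin : (1 - s) * Da + s * Db = 0) (hQ : QY ≤ Q) :
    wm - 2 * c / 2 * (s * (1 - s)) * Q ≤ (1 - s) * wa + s * wb := by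
  have h1 := mul_le_mul_of_nonneg_left ha (show 0 ≤ 1 - s by linarith)
  have h2 := mul_le_mul_of_nonneg_left hb hs0
  have h3 := mul_le_mul_of_nonneg_left hQ (show 0 ≤ c * (s * (1 - s)) by have := mul_nonneg hs0 (show 0 ≤ 1 - s by linarith); positivity)
  nlinarith [h1, h2, h3, hlin]

section Letters

variable {M : Matrix ι ι ℝ} {γop m lam : ℝ} {U : EuclideanSpace ℝ ι → ℝ} {U' : EuclideanSpace ℝ ι → EuclideanSpace ℝ ι →L[ℝ] ℝ}
  {U'' : EuclideanSpace ℝ ι → EuclideanSpace ℝ ι →L[ℝ] EuclideanSpace ℝ ι →L[ℝ] ℝ} {κ₀ κ₁ κ₂ a τ δ θ : ℝ}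

/-- **The output's derivative is `Y`-local** for a `Y`-local input: `(w⁺)′(ζ) = (w⁺)′(ζ^Y)`. [folklore] -/
theorem blockOutput_deriv_local (hM : M.PosDef) (hΓop : (γop • (1 : Matrix ι ι ℝ) - M⁻¹).PosSemidef) (Y : Finset ι)
    (hUd : ∀ φ : EuclideanSpace ℝ ι, HasFDerivAt U (U' φ) φ) (hU'd : ∀ φ : EuclideanSpace ℝ ι, HasFDerivAt U' (U'' φ) φ)
    (hU''c : Continuous U'') (hκ₀ : 0 ≤ κ₀) (hκ₁ : 0 ≤ κ₁) (ha : 0 ≤ a) (hκ₂ : 0 ≤ κ₂) (hτ : 0 < τ) (hδ : 0 < δ) (hθ0 : 0 < θ) (hθ1 : θ < 1)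
    (hκθ : (2 * κ₀ * (1 + τ) + 4 * δ) * γop ≤ θ) (hstab : ∀ φ : EuclideanSpace ℝ ι, -(κ₀ * ∑ x ∈ Y, φ x ^ 2) ≤ U φ)
    (hU'b : ∀ φ : EuclideanSpace ℝ ι, ‖U' φ‖ ≤ κ₁ * (a + ∑ x ∈ Y, φ x ^ 2)) (hU''b : ∀ φ : EuclideanSpace ℝ ι, ‖U'' φ‖ ≤ κ₂) (hUloc : ∀ φ φ' : EuclideanSpace ℝ ι, (∀ x ∈ Y,
        φ x = φ' x) → U φ = U φ') (ψ₀ ζ : EuclideanSpace ℝ ι) :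
    (((∫ ω : EuclideanSpace ℝ ι, exp (-U (ω + (ψ₀ + ζ))) ∂(multivariateGaussian 0 M⁻¹))⁻¹ • ∫ ω : EuclideanSpace ℝ ι, exp (-U (ω + (ψ₀ + ζ))) • U' (ω + (ψ₀ + ζ))
        ∂(multivariateGaussian 0 M⁻¹)) - ((∫ ω : EuclideanSpace ℝ ι, exp (-U (ω + ψ₀)) ∂(multivariateGaussian 0 M⁻¹))⁻¹ • ∫ ω : EuclideanSpace ℝ ι, exp (-U (ω + ψ₀)) • U'
        (ω + ψ₀) ∂(multivariateGaussian 0 M⁻¹)) - ((2 : ℝ)⁻¹ • (((∫ ω : EuclideanSpace ℝ ι, exp (-U (ω + ψ₀)) ∂(multivariateGaussian 0 M⁻¹))⁻¹ • (∫ ω : EuclideanSpace ℝ ι,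
        exp (-U (ω + ψ₀)) • (U'' (ω + ψ₀) - (U' (ω + ψ₀)).smulRight (U' (ω + ψ₀))) ∂(multivariateGaussian 0 M⁻¹)) + (((∫ ω : EuclideanSpace ℝ ι, exp (-U (ω + ψ₀))
        ∂(multivariateGaussian 0 M⁻¹)) ^ 2)⁻¹ • ∫ ω : EuclideanSpace ℝ ι, exp (-U (ω + ψ₀)) • U' (ω + ψ₀) ∂(multivariateGaussian 0 M⁻¹)).smulRight (∫ ω : EuclideanSpace ℝ
        ι, exp (-U (ω + ψ₀)) • U' (ω + ψ₀) ∂(multivariateGaussian 0 M⁻¹))) ζ + (((∫ ω : EuclideanSpace ℝ ι, exp (-U (ω + ψ₀)) ∂(multivariateGaussian 0 M⁻¹))⁻¹ • (∫ ω :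
        EuclideanSpace ℝ ι, exp (-U (ω + ψ₀)) • (U'' (ω + ψ₀) - (U' (ω + ψ₀)).smulRight (U' (ω + ψ₀))) ∂(multivariateGaussian 0 M⁻¹)) + (((∫ ω : EuclideanSpace ℝ ι, exp (-U
        (ω + ψ₀)) ∂(multivariateGaussian 0 M⁻¹)) ^ 2)⁻¹ • ∫ ω : EuclideanSpace ℝ ι, exp (-U (ω + ψ₀)) • U' (ω + ψ₀) ∂(multivariateGaussian 0 M⁻¹)).smulRight (∫ ω :
        EuclideanSpace ℝ ι, exp (-U (ω + ψ₀)) • U' (ω + ψ₀) ∂(multivariateGaussian 0 M⁻¹)))).flip ζ))) = (((∫ ω : EuclideanSpace ℝ ι, exp (-U (ω + (ψ₀ + (WithLp.toLp 2 (fun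
        x : ι => if x ∈ Y then ζ x else 0) : EuclideanSpace ℝ ι)))) ∂(multivariateGaussian 0 M⁻¹))⁻¹ • ∫ ω : EuclideanSpace ℝ ι, exp (-U (ω + (ψ₀ + (WithLp.toLp 2 (fun x :
        ι => if x ∈ Y then ζ x else 0) : EuclideanSpace ℝ ι)))) • U' (ω + (ψ₀ + (WithLp.toLp 2 (fun x : ι => if x ∈ Y then ζ x else 0) : EuclideanSpace ℝ ι)))
        ∂(multivariateGaussian 0 M⁻¹)) - ((∫ ω : EuclideanSpace ℝ ι, exp (-U (ω + ψ₀)) ∂(multivariateGaussian 0 M⁻¹))⁻¹ • ∫ ω : EuclideanSpace ℝ ι, exp (-U (ω + ψ₀)) • U'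
        (ω + ψ₀) ∂(multivariateGaussian 0 M⁻¹)) - ((2 : ℝ)⁻¹ • (((∫ ω : EuclideanSpace ℝ ι, exp (-U (ω + ψ₀)) ∂(multivariateGaussian 0 M⁻¹))⁻¹ • (∫ ω : EuclideanSpace ℝ ι,
        exp (-U (ω + ψ₀)) • (U'' (ω + ψ₀) - (U' (ω + ψ₀)).smulRight (U' (ω + ψ₀))) ∂(multivariateGaussian 0 M⁻¹)) + (((∫ ω : EuclideanSpace ℝ ι, exp (-U (ω + ψ₀))
        ∂(multivariateGaussian 0 M⁻¹)) ^ 2)⁻¹ • ∫ ω : EuclideanSpace ℝ ι, exp (-U (ω + ψ₀)) • U' (ω + ψ₀) ∂(multivariateGaussian 0 M⁻¹)).smulRight (∫ ω : EuclideanSpace ℝ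
        ι, exp (-U (ω + ψ₀)) • U' (ω + ψ₀) ∂(multivariateGaussian 0 M⁻¹))) (WithLp.toLp 2 (fun x : ι => if x ∈ Y then ζ x else 0) : EuclideanSpace ℝ ι) + (((∫ ω :
        EuclideanSpace ℝ ι, exp (-U (ω + ψ₀)) ∂(multivariateGaussian 0 M⁻¹))⁻¹ • (∫ ω : EuclideanSpace ℝ ι, exp (-U (ω + ψ₀)) • (U'' (ω + ψ₀) - (U' (ω + ψ₀)).smulRight (U'
        (ω + ψ₀))) ∂(multivariateGaussian 0 M⁻¹)) + (((∫ ω : EuclideanSpace ℝ ι, exp (-U (ω + ψ₀)) ∂(multivariateGaussian 0 M⁻¹)) ^ 2)⁻¹ • ∫ ω : EuclideanSpace ℝ ι, exp (-U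
        (ω + ψ₀)) • U' (ω + ψ₀) ∂(multivariateGaussian 0 M⁻¹)).smulRight (∫ ω : EuclideanSpace ℝ ι, exp (-U (ω + ψ₀)) • U' (ω + ψ₀) ∂(multivariateGaussian 0 M⁻¹)))).flip
        (WithLp.toLp 2 (fun x : ι => if x ∈ Y then ζ x else 0) : EuclideanSpace ℝ ι)))) := by
  have hΓ : (M⁻¹).PosSemidef := hM.inv.posSemidef
  have hU'c : Continuous U' := continuous_iff_continuousAt.2 fun φ => (hU'd φ).continuousAt
  have hag : ∀ x ∈ Y, (ψ₀ + ζ) x = (ψ₀ + (WithLp.toLp 2 (fun x : ι => if x ∈ Y then ζ x else 0) : EuclideanSpace ℝ ι)) x := fun x hx => by simp [hx]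
  have hoffv : ∀ x ∈ Y, (ζ - (WithLp.toLp 2 (fun x : ι => if x ∈ Y then ζ x else 0) : EuclideanSpace ℝ ι)) x = 0 := fun x hx => by simp [hx]
  have hD : ((∫ ω : EuclideanSpace ℝ ι, exp (-U (ω + (ψ₀ + ζ))) ∂(multivariateGaussian 0 M⁻¹))⁻¹ • ∫ ω : EuclideanSpace ℝ ι, exp (-U (ω + (ψ₀ + ζ))) • U' (ω + (ψ₀ + ζ))
      ∂(multivariateGaussian 0 M⁻¹)) = ((∫ ω : EuclideanSpace ℝ ι, exp (-U (ω + (ψ₀ + (WithLp.toLp 2 (fun x : ι => if x ∈ Y then ζ x else 0) : EuclideanSpace ℝ ι))))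
      ∂(multivariateGaussian 0 M⁻¹))⁻¹ • ∫ ω : EuclideanSpace ℝ ι, exp (-U (ω + (ψ₀ + (WithLp.toLp 2 (fun x : ι => if x ∈ Y then ζ x else 0) : EuclideanSpace ℝ ι)))) • U'
      (ω + (ψ₀ + (WithLp.toLp 2 (fun x : ι => if x ∈ Y then ζ x else 0) : EuclideanSpace ℝ ι))) ∂(multivariateGaussian 0 M⁻¹)) :=
    fderiv_local_of_local Y (fun ψ => hasFDerivAt_block_neg_log hΓ hΓop Y hUd hU'c hκ₀ hκ₁ ha hτ hδ hθ0 hθ1 hκθ hstab hU'b ψ) (block_W_local M⁻¹ Y hUloc) _ _ hag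
  have hL : ((∫ ω : EuclideanSpace ℝ ι, exp (-U (ω + ψ₀)) ∂(multivariateGaussian 0 M⁻¹))⁻¹ • (∫ ω : EuclideanSpace ℝ ι, exp (-U (ω + ψ₀)) • (U'' (ω + ψ₀) - (U' (ω +
      ψ₀)).smulRight (U' (ω + ψ₀))) ∂(multivariateGaussian 0 M⁻¹)) + (((∫ ω : EuclideanSpace ℝ ι, exp (-U (ω + ψ₀)) ∂(multivariateGaussian 0 M⁻¹)) ^ 2)⁻¹ • ∫ ω :
      EuclideanSpace ℝ ι, exp (-U (ω + ψ₀)) • U' (ω + ψ₀) ∂(multivariateGaussian 0 M⁻¹)).smulRight (∫ ω : EuclideanSpace ℝ ι, exp (-U (ω + ψ₀)) • U' (ω + ψ₀)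
      ∂(multivariateGaussian 0 M⁻¹))) ζ = ((∫ ω : EuclideanSpace ℝ ι, exp (-U (ω + ψ₀)) ∂(multivariateGaussian 0 M⁻¹))⁻¹ • (∫ ω : EuclideanSpace ℝ ι, exp (-U (ω + ψ₀)) •
      (U'' (ω + ψ₀) - (U' (ω + ψ₀)).smulRight (U' (ω + ψ₀))) ∂(multivariateGaussian 0 M⁻¹)) + (((∫ ω : EuclideanSpace ℝ ι, exp (-U (ω + ψ₀)) ∂(multivariateGaussian 0 M⁻¹))
      ^ 2)⁻¹ • ∫ ω : EuclideanSpace ℝ ι, exp (-U (ω + ψ₀)) • U' (ω + ψ₀) ∂(multivariateGaussian 0 M⁻¹)).smulRight (∫ ω : EuclideanSpace ℝ ι, exp (-U (ω + ψ₀)) • U' (ω + ψ₀)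
      ∂(multivariateGaussian 0 M⁻¹))) (WithLp.toLp 2 (fun x : ι => if x ∈ Y then ζ x else 0) : EuclideanSpace ℝ ι) := by
    rw [← sub_eq_zero, ← map_sub]; exact block_hessianCLM_apply_off hΓ hΓop Y hUd hU'd hU''c hκ₀ hκ₁ ha hκ₂ hτ hδ hθ0 hθ1 hκθ hstab hU'b hU''b hUloc ψ₀ _ hoffv
  have hLf : (((∫ ω : EuclideanSpace ℝ ι, exp (-U (ω + ψ₀)) ∂(multivariateGaussian 0 M⁻¹))⁻¹ • (∫ ω : EuclideanSpace ℝ ι, exp (-U (ω + ψ₀)) • (U'' (ω + ψ₀) - (U' (ω +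
      ψ₀)).smulRight (U' (ω + ψ₀))) ∂(multivariateGaussian 0 M⁻¹)) + (((∫ ω : EuclideanSpace ℝ ι, exp (-U (ω + ψ₀)) ∂(multivariateGaussian 0 M⁻¹)) ^ 2)⁻¹ • ∫ ω :
      EuclideanSpace ℝ ι, exp (-U (ω + ψ₀)) • U' (ω + ψ₀) ∂(multivariateGaussian 0 M⁻¹)).smulRight (∫ ω : EuclideanSpace ℝ ι, exp (-U (ω + ψ₀)) • U' (ω + ψ₀)
      ∂(multivariateGaussian 0 M⁻¹)))).flip ζ = (((∫ ω : EuclideanSpace ℝ ι, exp (-U (ω + ψ₀)) ∂(multivariateGaussian 0 M⁻¹))⁻¹ • (∫ ω : EuclideanSpace ℝ ι, exp (-U (ω +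
      ψ₀)) • (U'' (ω + ψ₀) - (U' (ω + ψ₀)).smulRight (U' (ω + ψ₀))) ∂(multivariateGaussian 0 M⁻¹)) + (((∫ ω : EuclideanSpace ℝ ι, exp (-U (ω + ψ₀)) ∂(multivariateGaussian 0
      M⁻¹)) ^ 2)⁻¹ • ∫ ω : EuclideanSpace ℝ ι, exp (-U (ω + ψ₀)) • U' (ω + ψ₀) ∂(multivariateGaussian 0 M⁻¹)).smulRight (∫ ω : EuclideanSpace ℝ ι, exp (-U (ω + ψ₀)) • U' (ω
      + ψ₀) ∂(multivariateGaussian 0 M⁻¹)))).flip (WithLp.toLp 2 (fun x : ι => if x ∈ Y then ζ x else 0) : EuclideanSpace ℝ ι) := by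
    rw [← sub_eq_zero, ← map_sub]
    ext k
    rw [ContinuousLinearMap.flip_apply, _root_.zero_apply]
    exact block_hessianCLM_apply_apply_off hΓ hΓop Y hUd hU'd hU''c hκ₀ hκ₁ ha hκ₂ hτ hδ hθ0 hθ1 hκθ hstab hU'b hU''b hUloc ψ₀ k _ hoffv
  rw [hD, hL, hLf]

/-- **THE OUTPUT'S GRADIENT LETTER IN THE INPUT FORMAT** for a `Y`-local input: `‖(w⁺)′(ζ)‖ ≤ (2λ+Λ)·(1 + Σ_Yζ²)` — the input's `hU'b` with
`κ₁⁺ = 2λ+Λ`, `a⁺ = 1`. [folklore] -/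
theorem blockOutput_gradient_letter_local (hM : M.PosDef) (hfl : ∀ z : ι → ℝ, m * ∑ i, z i ^ 2 ≤ z ⬝ᵥ (M *ᵥ z)) (hΓop : (γop • (1 : Matrix ι ι ℝ) - M⁻¹).PosSemidef) (Y :
    Finset ι)
    (hUd : ∀ φ : EuclideanSpace ℝ ι, HasFDerivAt U (U' φ) φ) (hU'd : ∀ φ : EuclideanSpace ℝ ι, HasFDerivAt U' (U'' φ) φ)
    (hU''c : Continuous U'') (hκ₀ : 0 ≤ κ₀) (hκ₁ : 0 ≤ κ₁) (ha : 0 ≤ a) (hκ₂ : 0 ≤ κ₂) (hτ : 0 < τ) (hδ : 0 < δ) (hθ0 : 0 < θ) (hθ1 : θ < 1)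
    (hκθ : (2 * κ₀ * (1 + τ) + 4 * δ) * γop ≤ θ) (hstab : ∀ φ : EuclideanSpace ℝ ι, -(κ₀ * ∑ x ∈ Y, φ x ^ 2) ≤ U φ)
    (hU'b : ∀ φ : EuclideanSpace ℝ ι, ‖U' φ‖ ≤ κ₁ * (a + ∑ x ∈ Y, φ x ^ 2)) (hU''b : ∀ φ : EuclideanSpace ℝ ι, ‖U'' φ‖ ≤ κ₂) {Λ : ℝ} (hΛ : 0 ≤ Λ)
    (hwup : ∀ φ φ' : EuclideanSpace ℝ ι, U φ' ≤ U φ + U' φ (φ' - φ) + Λ / 2 * ∑ x ∈ Y, (φ' x - φ x) ^ 2) (hlam : 0 ≤ lam)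
    (hUsec : ∀ s : ℝ, 0 ≤ s → s ≤ 1 → ∀ a b : EuclideanSpace ℝ ι,
      U ((1 - s) • a + s • b) - lam / 2 * (s * (1 - s)) * ∑ i, (a i - b i) ^ 2 ≤ (1 - s) * U a + s * U b)
    (hm : 2 * lam ≤ m) (hUloc : ∀ φ φ' : EuclideanSpace ℝ ι, (∀ x ∈ Y, φ x = φ' x) → U φ = U φ') (ψ₀ ζ : EuclideanSpace ℝ ι) :
    ‖(((∫ ω : EuclideanSpace ℝ ι, exp (-U (ω + (ψ₀ + ζ))) ∂(multivariateGaussian 0 M⁻¹))⁻¹ • ∫ ω : EuclideanSpace ℝ ι, exp (-U (ω + (ψ₀ + ζ))) • U' (ω + (ψ₀ + ζ))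
        ∂(multivariateGaussian 0 M⁻¹)) - ((∫ ω : EuclideanSpace ℝ ι, exp (-U (ω + ψ₀)) ∂(multivariateGaussian 0 M⁻¹))⁻¹ • ∫ ω : EuclideanSpace ℝ ι, exp (-U (ω + ψ₀)) • U'
        (ω + ψ₀) ∂(multivariateGaussian 0 M⁻¹)) - ((2 : ℝ)⁻¹ • (((∫ ω : EuclideanSpace ℝ ι, exp (-U (ω + ψ₀)) ∂(multivariateGaussian 0 M⁻¹))⁻¹ • (∫ ω : EuclideanSpace ℝ ι,
        exp (-U (ω + ψ₀)) • (U'' (ω + ψ₀) - (U' (ω + ψ₀)).smulRight (U' (ω + ψ₀))) ∂(multivariateGaussian 0 M⁻¹)) + (((∫ ω : EuclideanSpace ℝ ι, exp (-U (ω + ψ₀))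
        ∂(multivariateGaussian 0 M⁻¹)) ^ 2)⁻¹ • ∫ ω : EuclideanSpace ℝ ι, exp (-U (ω + ψ₀)) • U' (ω + ψ₀) ∂(multivariateGaussian 0 M⁻¹)).smulRight (∫ ω : EuclideanSpace ℝ
        ι, exp (-U (ω + ψ₀)) • U' (ω + ψ₀) ∂(multivariateGaussian 0 M⁻¹))) ζ + (((∫ ω : EuclideanSpace ℝ ι, exp (-U (ω + ψ₀)) ∂(multivariateGaussian 0 M⁻¹))⁻¹ • (∫ ω :
        EuclideanSpace ℝ ι, exp (-U (ω + ψ₀)) • (U'' (ω + ψ₀) - (U' (ω + ψ₀)).smulRight (U' (ω + ψ₀))) ∂(multivariateGaussian 0 M⁻¹)) + (((∫ ω : EuclideanSpace ℝ ι, exp (-U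
        (ω + ψ₀)) ∂(multivariateGaussian 0 M⁻¹)) ^ 2)⁻¹ • ∫ ω : EuclideanSpace ℝ ι, exp (-U (ω + ψ₀)) • U' (ω + ψ₀) ∂(multivariateGaussian 0 M⁻¹)).smulRight (∫ ω :
        EuclideanSpace ℝ ι, exp (-U (ω + ψ₀)) • U' (ω + ψ₀) ∂(multivariateGaussian 0 M⁻¹)))).flip ζ)))‖ ≤ (2 * lam + Λ) * (1 + (∑ x ∈ Y, ζ x ^ 2)) := by
  rw [blockOutput_deriv_local hM hΓop Y hUd hU'd hU''c hκ₀ hκ₁ ha hκ₂ hτ hδ hθ0 hθ1 hκθ hstab hU'b hU''b hUloc ψ₀ ζ]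
  have h := (blockOutput_gradient_letter hM hfl hΓop Y hUd hU'd hU''c hκ₀ hκ₁ ha hκ₂ hτ hδ hθ0 hθ1 hκθ hstab hU'b hU''b hΛ hwup hlam hUsec hm ψ₀ (WithLp.toLp 2 (fun x : ι
      => if x ∈ Y then ζ x else 0) : EuclideanSpace ℝ ι)).2
  have e1 : (∑ i, ((WithLp.toLp 2 (fun x : ι => if x ∈ Y then ζ x else 0) : EuclideanSpace ℝ ι)) i ^ 2) = (∑ x ∈ Y, ζ x ^ 2) := sum_sq_proj_univ Y (fun x => ζ x)
  rw [e1] at h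
  exact h

/-! ## §2. The two-point upper letter and the secant form for the output -/

/-- **THE OUTPUT'S TWO-POINT UPPER LETTER** for a `Y`-local input: `w⁺(ζ′) ≤ w⁺(ζ) + (w⁺)′(ζ)[ζ′−ζ] + ½(Λ+2λ)·Σ_Y(ζ′−ζ)²` — the input's
`hwup` with `Λ⁺ = Λ + 2λ`. [folklore] -/
theorem blockOutput_upper_letter (hM : M.PosDef) (hfl : ∀ z : ι → ℝ, m * ∑ i, z i ^ 2 ≤ z ⬝ᵥ (M *ᵥ z)) (hΓop : (γop • (1 : Matrix ι ι ℝ) - M⁻¹).PosSemidef) (Y : Finset ι)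
    (hUd : ∀ φ : EuclideanSpace ℝ ι, HasFDerivAt U (U' φ) φ) (hU'd : ∀ φ : EuclideanSpace ℝ ι, HasFDerivAt U' (U'' φ) φ)
    (hU''c : Continuous U'') (hκ₀ : 0 ≤ κ₀) (hκ₁ : 0 ≤ κ₁) (ha : 0 ≤ a) (hκ₂ : 0 ≤ κ₂) (hτ : 0 < τ) (hδ : 0 < δ) (hθ0 : 0 < θ) (hθ1 : θ < 1)
    (hκθ : (2 * κ₀ * (1 + τ) + 4 * δ) * γop ≤ θ) (hstab : ∀ φ : EuclideanSpace ℝ ι, -(κ₀ * ∑ x ∈ Y, φ x ^ 2) ≤ U φ)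
    (hU'b : ∀ φ : EuclideanSpace ℝ ι, ‖U' φ‖ ≤ κ₁ * (a + ∑ x ∈ Y, φ x ^ 2)) (hU''b : ∀ φ : EuclideanSpace ℝ ι, ‖U'' φ‖ ≤ κ₂) {Λ : ℝ}
    (hwup : ∀ φ φ' : EuclideanSpace ℝ ι, U φ' ≤ U φ + U' φ (φ' - φ) + Λ / 2 * ∑ x ∈ Y, (φ' x - φ x) ^ 2) (hlam : 0 ≤ lam)
    (hUsec : ∀ s : ℝ, 0 ≤ s → s ≤ 1 → ∀ a b : EuclideanSpace ℝ ι,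
      U ((1 - s) • a + s • b) - lam / 2 * (s * (1 - s)) * ∑ i, (a i - b i) ^ 2 ≤ (1 - s) * U a + s * U b)
    (hm : 2 * lam ≤ m) (hUloc : ∀ φ φ' : EuclideanSpace ℝ ι, (∀ x ∈ Y, φ x = φ' x) → U φ = U φ') (ψ₀ ζ ζ' : EuclideanSpace ℝ ι) :
    (fun ζ : EuclideanSpace ℝ ι => (-(Real.log (∫ ω : EuclideanSpace ℝ ι, exp (-U (ω + (ψ₀ + ζ))) ∂(multivariateGaussian 0 M⁻¹)) - Real.log (∫ ω : EuclideanSpace ℝ ι, exp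
        (-U (ω + ψ₀)) ∂(multivariateGaussian 0 M⁻¹)) + ((fun x : ι => ((∫ ω : EuclideanSpace ℝ ι, exp (-U (ω + ψ₀)) ∂(multivariateGaussian 0 M⁻¹))⁻¹ • ∫ ω : EuclideanSpace
        ℝ ι, exp (-U (ω + ψ₀)) • U' (ω + ψ₀) ∂(multivariateGaussian 0 M⁻¹)) (EuclideanSpace.single x (1 : ℝ))) ⬝ᵥ (WithLp.ofLp ζ)) + ((WithLp.ofLp ζ) ⬝ᵥ (Matrix.of fun x y
        : ι => (((∫ ω : EuclideanSpace ℝ ι, exp (-U (ω + ψ₀)) ∂(multivariateGaussian 0 M⁻¹))⁻¹ • (∫ ω : EuclideanSpace ℝ ι, exp (-U (ω + ψ₀)) • (U'' (ω + ψ₀) - (U' (ω +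
        ψ₀)).smulRight (U' (ω + ψ₀))) ∂(multivariateGaussian 0 M⁻¹)) + (((∫ ω : EuclideanSpace ℝ ι, exp (-U (ω + ψ₀)) ∂(multivariateGaussian 0 M⁻¹)) ^ 2)⁻¹ • ∫ ω :
        EuclideanSpace ℝ ι, exp (-U (ω + ψ₀)) • U' (ω + ψ₀) ∂(multivariateGaussian 0 M⁻¹)).smulRight (∫ ω : EuclideanSpace ℝ ι, exp (-U (ω + ψ₀)) • U' (ω + ψ₀)
        ∂(multivariateGaussian 0 M⁻¹))) (EuclideanSpace.single x (1 : ℝ)) (EuclideanSpace.single y (1 : ℝ)) + ((∫ ω : EuclideanSpace ℝ ι, exp (-U (ω + ψ₀))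
        ∂(multivariateGaussian 0 M⁻¹))⁻¹ • (∫ ω : EuclideanSpace ℝ ι, exp (-U (ω + ψ₀)) • (U'' (ω + ψ₀) - (U' (ω + ψ₀)).smulRight (U' (ω + ψ₀))) ∂(multivariateGaussian 0
        M⁻¹)) + (((∫ ω : EuclideanSpace ℝ ι, exp (-U (ω + ψ₀)) ∂(multivariateGaussian 0 M⁻¹)) ^ 2)⁻¹ • ∫ ω : EuclideanSpace ℝ ι, exp (-U (ω + ψ₀)) • U' (ω + ψ₀)
        ∂(multivariateGaussian 0 M⁻¹)).smulRight (∫ ω : EuclideanSpace ℝ ι, exp (-U (ω + ψ₀)) • U' (ω + ψ₀) ∂(multivariateGaussian 0 M⁻¹))) (EuclideanSpace.single y (1 :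
        ℝ)) (EuclideanSpace.single x (1 : ℝ))) / 2) *ᵥ (WithLp.ofLp ζ)) / 2))) ζ' ≤ (fun ζ : EuclideanSpace ℝ ι => (-(Real.log (∫ ω : EuclideanSpace ℝ ι, exp (-U (ω + (ψ₀ +
        ζ))) ∂(multivariateGaussian 0 M⁻¹)) - Real.log (∫ ω : EuclideanSpace ℝ ι, exp (-U (ω + ψ₀)) ∂(multivariateGaussian 0 M⁻¹)) + ((fun x : ι => ((∫ ω : EuclideanSpace ℝ
        ι, exp (-U (ω + ψ₀)) ∂(multivariateGaussian 0 M⁻¹))⁻¹ • ∫ ω : EuclideanSpace ℝ ι, exp (-U (ω + ψ₀)) • U' (ω + ψ₀) ∂(multivariateGaussian 0 M⁻¹))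
        (EuclideanSpace.single x (1 : ℝ))) ⬝ᵥ (WithLp.ofLp ζ)) + ((WithLp.ofLp ζ) ⬝ᵥ (Matrix.of fun x y : ι => (((∫ ω : EuclideanSpace ℝ ι, exp (-U (ω + ψ₀))
        ∂(multivariateGaussian 0 M⁻¹))⁻¹ • (∫ ω : EuclideanSpace ℝ ι, exp (-U (ω + ψ₀)) • (U'' (ω + ψ₀) - (U' (ω + ψ₀)).smulRight (U' (ω + ψ₀))) ∂(multivariateGaussian 0
        M⁻¹)) + (((∫ ω : EuclideanSpace ℝ ι, exp (-U (ω + ψ₀)) ∂(multivariateGaussian 0 M⁻¹)) ^ 2)⁻¹ • ∫ ω : EuclideanSpace ℝ ι, exp (-U (ω + ψ₀)) • U' (ω + ψ₀)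
        ∂(multivariateGaussian 0 M⁻¹)).smulRight (∫ ω : EuclideanSpace ℝ ι, exp (-U (ω + ψ₀)) • U' (ω + ψ₀) ∂(multivariateGaussian 0 M⁻¹))) (EuclideanSpace.single x (1 :
        ℝ)) (EuclideanSpace.single y (1 : ℝ)) + ((∫ ω : EuclideanSpace ℝ ι, exp (-U (ω + ψ₀)) ∂(multivariateGaussian 0 M⁻¹))⁻¹ • (∫ ω : EuclideanSpace ℝ ι, exp (-U (ω +
        ψ₀)) • (U'' (ω + ψ₀) - (U' (ω + ψ₀)).smulRight (U' (ω + ψ₀))) ∂(multivariateGaussian 0 M⁻¹)) + (((∫ ω : EuclideanSpace ℝ ι, exp (-U (ω + ψ₀)) ∂(multivariateGaussian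
        0 M⁻¹)) ^ 2)⁻¹ • ∫ ω : EuclideanSpace ℝ ι, exp (-U (ω + ψ₀)) • U' (ω + ψ₀) ∂(multivariateGaussian 0 M⁻¹)).smulRight (∫ ω : EuclideanSpace ℝ ι, exp (-U (ω + ψ₀)) •
        U' (ω + ψ₀) ∂(multivariateGaussian 0 M⁻¹))) (EuclideanSpace.single y (1 : ℝ)) (EuclideanSpace.single x (1 : ℝ))) / 2) *ᵥ (WithLp.ofLp ζ)) / 2))) ζ + (((∫ ω :
        EuclideanSpace ℝ ι, exp (-U (ω + (ψ₀ + ζ))) ∂(multivariateGaussian 0 M⁻¹))⁻¹ • ∫ ω : EuclideanSpace ℝ ι, exp (-U (ω + (ψ₀ + ζ))) • U' (ω + (ψ₀ + ζ))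
        ∂(multivariateGaussian 0 M⁻¹)) - ((∫ ω : EuclideanSpace ℝ ι, exp (-U (ω + ψ₀)) ∂(multivariateGaussian 0 M⁻¹))⁻¹ • ∫ ω : EuclideanSpace ℝ ι, exp (-U (ω + ψ₀)) • U'
        (ω + ψ₀) ∂(multivariateGaussian 0 M⁻¹)) - ((2 : ℝ)⁻¹ • (((∫ ω : EuclideanSpace ℝ ι, exp (-U (ω + ψ₀)) ∂(multivariateGaussian 0 M⁻¹))⁻¹ • (∫ ω : EuclideanSpace ℝ ι,
        exp (-U (ω + ψ₀)) • (U'' (ω + ψ₀) - (U' (ω + ψ₀)).smulRight (U' (ω + ψ₀))) ∂(multivariateGaussian 0 M⁻¹)) + (((∫ ω : EuclideanSpace ℝ ι, exp (-U (ω + ψ₀))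
        ∂(multivariateGaussian 0 M⁻¹)) ^ 2)⁻¹ • ∫ ω : EuclideanSpace ℝ ι, exp (-U (ω + ψ₀)) • U' (ω + ψ₀) ∂(multivariateGaussian 0 M⁻¹)).smulRight (∫ ω : EuclideanSpace ℝ
        ι, exp (-U (ω + ψ₀)) • U' (ω + ψ₀) ∂(multivariateGaussian 0 M⁻¹))) ζ + (((∫ ω : EuclideanSpace ℝ ι, exp (-U (ω + ψ₀)) ∂(multivariateGaussian 0 M⁻¹))⁻¹ • (∫ ω :
        EuclideanSpace ℝ ι, exp (-U (ω + ψ₀)) • (U'' (ω + ψ₀) - (U' (ω + ψ₀)).smulRight (U' (ω + ψ₀))) ∂(multivariateGaussian 0 M⁻¹)) + (((∫ ω : EuclideanSpace ℝ ι, exp (-U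
        (ω + ψ₀)) ∂(multivariateGaussian 0 M⁻¹)) ^ 2)⁻¹ • ∫ ω : EuclideanSpace ℝ ι, exp (-U (ω + ψ₀)) • U' (ω + ψ₀) ∂(multivariateGaussian 0 M⁻¹)).smulRight (∫ ω :
        EuclideanSpace ℝ ι, exp (-U (ω + ψ₀)) • U' (ω + ψ₀) ∂(multivariateGaussian 0 M⁻¹)))).flip ζ))) (ζ' - ζ) + (Λ + 2 * lam) / 2 * ∑ x ∈ Y, (ζ' x - ζ x) ^ 2 := by
  have hU'c : Continuous U' := continuous_iff_continuousAt.2 fun φ => (hU'd φ).continuousAt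
  have hinc := blockOutput_increment_eq (U'' := U'') hM hΓop Y hUd hU'c hκ₀ hκ₁ ha hτ hδ hθ0 hθ1 hκθ hstab hU'b ψ₀ ζ ζ'
  have hcl := (block_residual_second_order_class_local hM hfl hΓop Y hUd hU'd hU''c hκ₀ hκ₁ ha hκ₂ hτ hδ hθ0 hθ1 hκθ hstab hU'b hU''b hwup hlam hUsec hm hUloc ψ₀ ζ ζ').2
  rw [← hinc] at hcl
  linarith

/-- **THE OUTPUT'S SECANT LOWER LETTER** for a `Y`-local input: for `0 ≤ s ≤ 1` and all `a, b`,
`w⁺((1−s)a + sb) − ½(2λ+Λ)·s(1−s)·Σ_i(a_i−b_i)² ≤ (1−s)w⁺(a) + s·w⁺(b)` — the input's `hUsec` with `λ⁺ = 2λ+Λ` (tangent letter at the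
intermediate point towards both ends; `Σ_Y ≤ Σ_i`). [folklore] -/
theorem blockOutput_secant (hM : M.PosDef) (hfl : ∀ z : ι → ℝ, m * ∑ i, z i ^ 2 ≤ z ⬝ᵥ (M *ᵥ z)) (hΓop : (γop • (1 : Matrix ι ι ℝ) - M⁻¹).PosSemidef) (Y : Finset ι)
    (hUd : ∀ φ : EuclideanSpace ℝ ι, HasFDerivAt U (U' φ) φ) (hU'd : ∀ φ : EuclideanSpace ℝ ι, HasFDerivAt U' (U'' φ) φ)
    (hU''c : Continuous U'') (hκ₀ : 0 ≤ κ₀) (hκ₁ : 0 ≤ κ₁) (ha : 0 ≤ a) (hκ₂ : 0 ≤ κ₂) (hτ : 0 < τ) (hδ : 0 < δ) (hθ0 : 0 < θ) (hθ1 : θ < 1)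
    (hκθ : (2 * κ₀ * (1 + τ) + 4 * δ) * γop ≤ θ) (hstab : ∀ φ : EuclideanSpace ℝ ι, -(κ₀ * ∑ x ∈ Y, φ x ^ 2) ≤ U φ)
    (hU'b : ∀ φ : EuclideanSpace ℝ ι, ‖U' φ‖ ≤ κ₁ * (a + ∑ x ∈ Y, φ x ^ 2)) (hU''b : ∀ φ : EuclideanSpace ℝ ι, ‖U'' φ‖ ≤ κ₂) {Λ : ℝ} (hΛ : 0 ≤ Λ)
    (hwup : ∀ φ φ' : EuclideanSpace ℝ ι, U φ' ≤ U φ + U' φ (φ' - φ) + Λ / 2 * ∑ x ∈ Y, (φ' x - φ x) ^ 2) (hlam : 0 ≤ lam)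
    (hUsec : ∀ s : ℝ, 0 ≤ s → s ≤ 1 → ∀ a b : EuclideanSpace ℝ ι,
      U ((1 - s) • a + s • b) - lam / 2 * (s * (1 - s)) * ∑ i, (a i - b i) ^ 2 ≤ (1 - s) * U a + s * U b)
    (hm : 2 * lam ≤ m) (hUloc : ∀ φ φ' : EuclideanSpace ℝ ι, (∀ x ∈ Y, φ x = φ' x) → U φ = U φ') (ψ₀ : EuclideanSpace ℝ ι)
    (s : ℝ) (hs0 : 0 ≤ s) (hs1 : s ≤ 1) (a' b' : EuclideanSpace ℝ ι) :
    (fun ζ : EuclideanSpace ℝ ι => (-(Real.log (∫ ω : EuclideanSpace ℝ ι, exp (-U (ω + (ψ₀ + ζ))) ∂(multivariateGaussian 0 M⁻¹)) - Real.log (∫ ω : EuclideanSpace ℝ ι, exp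
        (-U (ω + ψ₀)) ∂(multivariateGaussian 0 M⁻¹)) + ((fun x : ι => ((∫ ω : EuclideanSpace ℝ ι, exp (-U (ω + ψ₀)) ∂(multivariateGaussian 0 M⁻¹))⁻¹ • ∫ ω : EuclideanSpace
        ℝ ι, exp (-U (ω + ψ₀)) • U' (ω + ψ₀) ∂(multivariateGaussian 0 M⁻¹)) (EuclideanSpace.single x (1 : ℝ))) ⬝ᵥ (WithLp.ofLp ζ)) + ((WithLp.ofLp ζ) ⬝ᵥ (Matrix.of fun x y
        : ι => (((∫ ω : EuclideanSpace ℝ ι, exp (-U (ω + ψ₀)) ∂(multivariateGaussian 0 M⁻¹))⁻¹ • (∫ ω : EuclideanSpace ℝ ι, exp (-U (ω + ψ₀)) • (U'' (ω + ψ₀) - (U' (ω +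
        ψ₀)).smulRight (U' (ω + ψ₀))) ∂(multivariateGaussian 0 M⁻¹)) + (((∫ ω : EuclideanSpace ℝ ι, exp (-U (ω + ψ₀)) ∂(multivariateGaussian 0 M⁻¹)) ^ 2)⁻¹ • ∫ ω :
        EuclideanSpace ℝ ι, exp (-U (ω + ψ₀)) • U' (ω + ψ₀) ∂(multivariateGaussian 0 M⁻¹)).smulRight (∫ ω : EuclideanSpace ℝ ι, exp (-U (ω + ψ₀)) • U' (ω + ψ₀)
        ∂(multivariateGaussian 0 M⁻¹))) (EuclideanSpace.single x (1 : ℝ)) (EuclideanSpace.single y (1 : ℝ)) + ((∫ ω : EuclideanSpace ℝ ι, exp (-U (ω + ψ₀))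
        ∂(multivariateGaussian 0 M⁻¹))⁻¹ • (∫ ω : EuclideanSpace ℝ ι, exp (-U (ω + ψ₀)) • (U'' (ω + ψ₀) - (U' (ω + ψ₀)).smulRight (U' (ω + ψ₀))) ∂(multivariateGaussian 0
        M⁻¹)) + (((∫ ω : EuclideanSpace ℝ ι, exp (-U (ω + ψ₀)) ∂(multivariateGaussian 0 M⁻¹)) ^ 2)⁻¹ • ∫ ω : EuclideanSpace ℝ ι, exp (-U (ω + ψ₀)) • U' (ω + ψ₀)
        ∂(multivariateGaussian 0 M⁻¹)).smulRight (∫ ω : EuclideanSpace ℝ ι, exp (-U (ω + ψ₀)) • U' (ω + ψ₀) ∂(multivariateGaussian 0 M⁻¹))) (EuclideanSpace.single y (1 :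
        ℝ)) (EuclideanSpace.single x (1 : ℝ))) / 2) *ᵥ (WithLp.ofLp ζ)) / 2))) ((1 - s) • a' + s • b') - (2 * lam + Λ) / 2 * (s * (1 - s)) * ∑ i, (a' i - b' i) ^ 2 ≤
      (1 - s) * (fun ζ : EuclideanSpace ℝ ι => (-(Real.log (∫ ω : EuclideanSpace ℝ ι, exp (-U (ω + (ψ₀ + ζ))) ∂(multivariateGaussian 0 M⁻¹)) - Real.log (∫ ω :
          EuclideanSpace ℝ ι, exp (-U (ω + ψ₀)) ∂(multivariateGaussian 0 M⁻¹)) + ((fun x : ι => ((∫ ω : EuclideanSpace ℝ ι, exp (-U (ω + ψ₀)) ∂(multivariateGaussian 0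
          M⁻¹))⁻¹ • ∫ ω : EuclideanSpace ℝ ι, exp (-U (ω + ψ₀)) • U' (ω + ψ₀) ∂(multivariateGaussian 0 M⁻¹)) (EuclideanSpace.single x (1 : ℝ))) ⬝ᵥ (WithLp.ofLp ζ)) +
          ((WithLp.ofLp ζ) ⬝ᵥ (Matrix.of fun x y : ι => (((∫ ω : EuclideanSpace ℝ ι, exp (-U (ω + ψ₀)) ∂(multivariateGaussian 0 M⁻¹))⁻¹ • (∫ ω : EuclideanSpace ℝ ι, exp (-U
          (ω + ψ₀)) • (U'' (ω + ψ₀) - (U' (ω + ψ₀)).smulRight (U' (ω + ψ₀))) ∂(multivariateGaussian 0 M⁻¹)) + (((∫ ω : EuclideanSpace ℝ ι, exp (-U (ω + ψ₀))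
          ∂(multivariateGaussian 0 M⁻¹)) ^ 2)⁻¹ • ∫ ω : EuclideanSpace ℝ ι, exp (-U (ω + ψ₀)) • U' (ω + ψ₀) ∂(multivariateGaussian 0 M⁻¹)).smulRight (∫ ω : EuclideanSpace ℝ
          ι, exp (-U (ω + ψ₀)) • U' (ω + ψ₀) ∂(multivariateGaussian 0 M⁻¹))) (EuclideanSpace.single x (1 : ℝ)) (EuclideanSpace.single y (1 : ℝ)) + ((∫ ω : EuclideanSpace ℝ
          ι, exp (-U (ω + ψ₀)) ∂(multivariateGaussian 0 M⁻¹))⁻¹ • (∫ ω : EuclideanSpace ℝ ι, exp (-U (ω + ψ₀)) • (U'' (ω + ψ₀) - (U' (ω + ψ₀)).smulRight (U' (ω + ψ₀)))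
          ∂(multivariateGaussian 0 M⁻¹)) + (((∫ ω : EuclideanSpace ℝ ι, exp (-U (ω + ψ₀)) ∂(multivariateGaussian 0 M⁻¹)) ^ 2)⁻¹ • ∫ ω : EuclideanSpace ℝ ι, exp (-U (ω +
          ψ₀)) • U' (ω + ψ₀) ∂(multivariateGaussian 0 M⁻¹)).smulRight (∫ ω : EuclideanSpace ℝ ι, exp (-U (ω + ψ₀)) • U' (ω + ψ₀) ∂(multivariateGaussian 0 M⁻¹)))
          (EuclideanSpace.single y (1 : ℝ)) (EuclideanSpace.single x (1 : ℝ))) / 2) *ᵥ (WithLp.ofLp ζ)) / 2))) a' + s * (fun ζ : EuclideanSpace ℝ ι => (-(Real.log (∫ ω :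
          EuclideanSpace ℝ ι, exp (-U (ω + (ψ₀ + ζ))) ∂(multivariateGaussian 0 M⁻¹)) - Real.log (∫ ω : EuclideanSpace ℝ ι, exp (-U (ω + ψ₀)) ∂(multivariateGaussian 0 M⁻¹))
          + ((fun x : ι => ((∫ ω : EuclideanSpace ℝ ι, exp (-U (ω + ψ₀)) ∂(multivariateGaussian 0 M⁻¹))⁻¹ • ∫ ω : EuclideanSpace ℝ ι, exp (-U (ω + ψ₀)) • U' (ω + ψ₀)
          ∂(multivariateGaussian 0 M⁻¹)) (EuclideanSpace.single x (1 : ℝ))) ⬝ᵥ (WithLp.ofLp ζ)) + ((WithLp.ofLp ζ) ⬝ᵥ (Matrix.of fun x y : ι => (((∫ ω : EuclideanSpace ℝ ι,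
          exp (-U (ω + ψ₀)) ∂(multivariateGaussian 0 M⁻¹))⁻¹ • (∫ ω : EuclideanSpace ℝ ι, exp (-U (ω + ψ₀)) • (U'' (ω + ψ₀) - (U' (ω + ψ₀)).smulRight (U' (ω + ψ₀)))
          ∂(multivariateGaussian 0 M⁻¹)) + (((∫ ω : EuclideanSpace ℝ ι, exp (-U (ω + ψ₀)) ∂(multivariateGaussian 0 M⁻¹)) ^ 2)⁻¹ • ∫ ω : EuclideanSpace ℝ ι, exp (-U (ω +
          ψ₀)) • U' (ω + ψ₀) ∂(multivariateGaussian 0 M⁻¹)).smulRight (∫ ω : EuclideanSpace ℝ ι, exp (-U (ω + ψ₀)) • U' (ω + ψ₀) ∂(multivariateGaussian 0 M⁻¹)))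
          (EuclideanSpace.single x (1 : ℝ)) (EuclideanSpace.single y (1 : ℝ)) + ((∫ ω : EuclideanSpace ℝ ι, exp (-U (ω + ψ₀)) ∂(multivariateGaussian 0 M⁻¹))⁻¹ • (∫ ω :
          EuclideanSpace ℝ ι, exp (-U (ω + ψ₀)) • (U'' (ω + ψ₀) - (U' (ω + ψ₀)).smulRight (U' (ω + ψ₀))) ∂(multivariateGaussian 0 M⁻¹)) + (((∫ ω : EuclideanSpace ℝ ι, exp
          (-U (ω + ψ₀)) ∂(multivariateGaussian 0 M⁻¹)) ^ 2)⁻¹ • ∫ ω : EuclideanSpace ℝ ι, exp (-U (ω + ψ₀)) • U' (ω + ψ₀) ∂(multivariateGaussian 0 M⁻¹)).smulRight (∫ ω :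
          EuclideanSpace ℝ ι, exp (-U (ω + ψ₀)) • U' (ω + ψ₀) ∂(multivariateGaussian 0 M⁻¹))) (EuclideanSpace.single y (1 : ℝ)) (EuclideanSpace.single x (1 : ℝ))) / 2) *ᵥ
          (WithLp.ofLp ζ)) / 2))) b' := by
  have hU'c : Continuous U' := continuous_iff_continuousAt.2 fun φ => (hU'd φ).continuousAt
  set mpt : EuclideanSpace ℝ ι := (1 - s) • a' + s • b' with hmpt
  -- tangent letters at `mpt` towards `a'` and `b'`
  have ha' := (block_residual_second_order_class_local hM hfl hΓop Y hUd hU'd hU''c hκ₀ hκ₁ ha hκ₂ hτ hδ hθ0 hθ1 hκθ hstab hU'b hU''b hwup hlam hUsec hm hUloc ψ₀ mpt a').1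
  have hb' := (block_residual_second_order_class_local hM hfl hΓop Y hUd hU'd hU''c hκ₀ hκ₁ ha hκ₂ hτ hδ hθ0 hθ1 hκθ hstab hU'b hU''b hwup hlam hUsec hm hUloc ψ₀ mpt b').1
  rw [← blockOutput_increment_eq (U'' := U'') hM hΓop Y hUd hU'c hκ₀ hκ₁ ha hτ hδ hθ0 hθ1 hκθ hstab hU'b ψ₀ mpt a'] at ha'
  rw [← blockOutput_increment_eq (U'' := U'') hM hΓop Y hUd hU'c hκ₀ hκ₁ ha hτ hδ hθ0 hθ1 hκθ hstab hU'b ψ₀ mpt b'] at hb'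
  -- the linear parts cancel
  have hlin : (1 - s) * (((∫ ω : EuclideanSpace ℝ ι, exp (-U (ω + (ψ₀ + mpt))) ∂(multivariateGaussian 0 M⁻¹))⁻¹ • ∫ ω : EuclideanSpace ℝ ι, exp (-U (ω + (ψ₀ + mpt))) • U'
      (ω + (ψ₀ + mpt)) ∂(multivariateGaussian 0 M⁻¹)) - ((∫ ω : EuclideanSpace ℝ ι, exp (-U (ω + ψ₀)) ∂(multivariateGaussian 0 M⁻¹))⁻¹ • ∫ ω : EuclideanSpace ℝ ι, exp (-U
      (ω + ψ₀)) • U' (ω + ψ₀) ∂(multivariateGaussian 0 M⁻¹)) - ((2 : ℝ)⁻¹ • (((∫ ω : EuclideanSpace ℝ ι, exp (-U (ω + ψ₀)) ∂(multivariateGaussian 0 M⁻¹))⁻¹ • (∫ ω :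
      EuclideanSpace ℝ ι, exp (-U (ω + ψ₀)) • (U'' (ω + ψ₀) - (U' (ω + ψ₀)).smulRight (U' (ω + ψ₀))) ∂(multivariateGaussian 0 M⁻¹)) + (((∫ ω : EuclideanSpace ℝ ι, exp (-U
      (ω + ψ₀)) ∂(multivariateGaussian 0 M⁻¹)) ^ 2)⁻¹ • ∫ ω : EuclideanSpace ℝ ι, exp (-U (ω + ψ₀)) • U' (ω + ψ₀) ∂(multivariateGaussian 0 M⁻¹)).smulRight (∫ ω :
      EuclideanSpace ℝ ι, exp (-U (ω + ψ₀)) • U' (ω + ψ₀) ∂(multivariateGaussian 0 M⁻¹))) mpt + (((∫ ω : EuclideanSpace ℝ ι, exp (-U (ω + ψ₀)) ∂(multivariateGaussian 0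
      M⁻¹))⁻¹ • (∫ ω : EuclideanSpace ℝ ι, exp (-U (ω + ψ₀)) • (U'' (ω + ψ₀) - (U' (ω + ψ₀)).smulRight (U' (ω + ψ₀))) ∂(multivariateGaussian 0 M⁻¹)) + (((∫ ω :
      EuclideanSpace ℝ ι, exp (-U (ω + ψ₀)) ∂(multivariateGaussian 0 M⁻¹)) ^ 2)⁻¹ • ∫ ω : EuclideanSpace ℝ ι, exp (-U (ω + ψ₀)) • U' (ω + ψ₀) ∂(multivariateGaussian 0
      M⁻¹)).smulRight (∫ ω : EuclideanSpace ℝ ι, exp (-U (ω + ψ₀)) • U' (ω + ψ₀) ∂(multivariateGaussian 0 M⁻¹)))).flip mpt))) (a' - mpt) + s * (((∫ ω : EuclideanSpace ℝ ι,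
      exp (-U (ω + (ψ₀ + mpt))) ∂(multivariateGaussian 0 M⁻¹))⁻¹ • ∫ ω : EuclideanSpace ℝ ι, exp (-U (ω + (ψ₀ + mpt))) • U' (ω + (ψ₀ + mpt)) ∂(multivariateGaussian 0 M⁻¹))
      - ((∫ ω : EuclideanSpace ℝ ι, exp (-U (ω + ψ₀)) ∂(multivariateGaussian 0 M⁻¹))⁻¹ • ∫ ω : EuclideanSpace ℝ ι, exp (-U (ω + ψ₀)) • U' (ω + ψ₀) ∂(multivariateGaussian 0
      M⁻¹)) - ((2 : ℝ)⁻¹ • (((∫ ω : EuclideanSpace ℝ ι, exp (-U (ω + ψ₀)) ∂(multivariateGaussian 0 M⁻¹))⁻¹ • (∫ ω : EuclideanSpace ℝ ι, exp (-U (ω + ψ₀)) • (U'' (ω + ψ₀) -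
      (U' (ω + ψ₀)).smulRight (U' (ω + ψ₀))) ∂(multivariateGaussian 0 M⁻¹)) + (((∫ ω : EuclideanSpace ℝ ι, exp (-U (ω + ψ₀)) ∂(multivariateGaussian 0 M⁻¹)) ^ 2)⁻¹ • ∫ ω :
      EuclideanSpace ℝ ι, exp (-U (ω + ψ₀)) • U' (ω + ψ₀) ∂(multivariateGaussian 0 M⁻¹)).smulRight (∫ ω : EuclideanSpace ℝ ι, exp (-U (ω + ψ₀)) • U' (ω + ψ₀)
      ∂(multivariateGaussian 0 M⁻¹))) mpt + (((∫ ω : EuclideanSpace ℝ ι, exp (-U (ω + ψ₀)) ∂(multivariateGaussian 0 M⁻¹))⁻¹ • (∫ ω : EuclideanSpace ℝ ι, exp (-U (ω + ψ₀)) •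
      (U'' (ω + ψ₀) - (U' (ω + ψ₀)).smulRight (U' (ω + ψ₀))) ∂(multivariateGaussian 0 M⁻¹)) + (((∫ ω : EuclideanSpace ℝ ι, exp (-U (ω + ψ₀)) ∂(multivariateGaussian 0 M⁻¹))
      ^ 2)⁻¹ • ∫ ω : EuclideanSpace ℝ ι, exp (-U (ω + ψ₀)) • U' (ω + ψ₀) ∂(multivariateGaussian 0 M⁻¹)).smulRight (∫ ω : EuclideanSpace ℝ ι, exp (-U (ω + ψ₀)) • U' (ω + ψ₀)
      ∂(multivariateGaussian 0 M⁻¹)))).flip mpt))) (b' - mpt) = 0 := by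
    rw [← smul_eq_mul, ← smul_eq_mul, ← map_smul, ← map_smul, ← map_add]
    have e0 : (1 - s) • (a' - mpt) + s • (b' - mpt) = 0 := by
      rw [hmpt]; ext x; simp only [PiLp.add_apply, PiLp.smul_apply, PiLp.sub_apply, smul_eq_mul, PiLp.zero_apply]; ring
    rw [e0, map_zero]
  -- the quadratic parts
  have hqa : ∑ x ∈ Y, (a' x - mpt x) ^ 2 = s ^ 2 * ∑ x ∈ Y, (a' x - b' x) ^ 2 := by
    rw [Finset.mul_sum]; refine Finset.sum_congr rfl fun x _ => ?_
    rw [hmpt]; simp only [PiLp.add_apply, PiLp.smul_apply, smul_eq_mul]; ring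
  have hqb : ∑ x ∈ Y, (b' x - mpt x) ^ 2 = (1 - s) ^ 2 * ∑ x ∈ Y, (a' x - b' x) ^ 2 := by
    rw [Finset.mul_sum]; refine Finset.sum_congr rfl fun x _ => ?_
    rw [hmpt]; simp only [PiLp.add_apply, PiLp.smul_apply, smul_eq_mul]; ring
  have hY : ∑ x ∈ Y, (a' x - b' x) ^ 2 ≤ ∑ i, (a' i - b' i) ^ 2 := Finset.sum_le_univ_sum_of_nonneg fun i => sq_nonneg _
  rw [hqa] at ha'
  rw [hqb] at hb'
  have key := secant_arith (c := lam + Λ / 2) (by positivity) hs0 hs1 ha' hb' hlin hY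
  have e : 2 * (lam + Λ / 2) / 2 = (2 * lam + Λ) / 2 := by ring
  rw [e] at key
  exact key

end Letters


/-! ## §3. Toy -/

/-- Toy (§1's arithmetic): with `s = 0` the secant letter is `w_m ≤ w_a` given the tangent letter towards `a`. -/
example (c wa wb wm Da Db QY Q : ℝ) (hc : 0 ≤ c) (ha : -(c * ((0:ℝ) ^ 2 * QY)) ≤ wa - wm - Da)
    (hb : -(c * ((1 - 0) ^ 2 * QY)) ≤ wb - wm - Db) (hlin : (1 - 0) * Da + 0 * Db = 0) (hQ : QY ≤ Q) :
    wm - 2 * c / 2 * (0 * (1 - 0)) * Q ≤ (1 - 0) * wa + 0 * wb :=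
  secant_arith hc le_rfl zero_le_one ha hb hlin hQ

end Summit.QuantumFields.BalabanUV.T4Continuum.NE7b.SupBlockOutputLetters
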